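import Literature.IUT.HodgeArakelov.ThetaSettingDeltaCharacteristicCompletion
import Literature.IUT.HodgeArakelov.MonoThetaCyclotomesBridgeEtTh
import Literature.AnabelianGeometry.SemiGraphs.TemperedCurveGalois
import Literature.AnabelianGeometry.SemiGraphs.TemperedCompletionExistence
import HarnessLib

/-!
# (H1) «`Δ ⊆ Π` is characteristic» at the GENUINE [IUTchII] §1 setting of the Tate curve `X̲̲_K`:
# the completion package exists, and (H1) holds modulo one [AbsTopI] Thm 2.6 regime on it

S. Mochizuki, *Inter-universal Teichmüller theory II*, §1, Example 1.8 (i) (kurims p. 35, l. 45–48, verbatim):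
«α : Π/Δ ⥲ G, where we write Δ ⊆ Π for the [group-theoretic! — cf., e.g., [AbsAnab], Lemma 1.3.8] subgroup
corresponding to Δ^tp_{X̲̲_k}» [claim: Mochizuki2012, status: disputed]; OUR PARAPHRASE (not print's words): the
subgroup `Δ ⊆ Π` may be characterized group-theoretically.  Continuation
of `ThetaSettingDeltaCharacteristicCompletion.lean` (abc-iut-w5-d233, p427416), whose tempered reduction
`ThetaSetting.deltaX_map_eq_of_isProfiniteCompletion` takes as data a profinite completion
`ι : Π^{(S)} → Π_E` into an extension `E : FundamentalExtension` together with the clause `Δ^{(S)} = ι⁻¹(Δ_E)`.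

THIS PROOF-ONLY FILE (no definitions, no named facts; witnesses are built inside the proofs):

* `ThetaSetting.deltaX_eq_comap_of_aug_compatible` — the clause `Δ^{(S)} = ι⁻¹(Δ_E)` is AUTOMATIC when
  the augmentations are compatible: `aug_E ∘ ι = g ∘ aug_S` with `g : G_k → G_E` injective (three lines);
* `ThetaSetting.deltaX_map_eq_of_completion_compatible` (+ the regimes `…_coinvariantRankConstant` /
  `…_starCondition` / `…_proSigma`) — tempered (H1) from a COMPATIBLE completion package + one [AbsTopI] Thm 2.6
  regime on `E` in FACT-LIST currency (F-0001 / F-0011 + F-0012 / pro-`Σ`, `Σ ⊊ Primes`);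
* `ThetaSetting.exists_completion_package` — NON-VACUITY of the package: EVERY setting `S` whose `G_k` is
  identified with Mathlib's `Gal(K̄/K)` for a finite extension `K/ℚ_p` admits a compatible completion package
  with MLF base data: `Π_E :=` the profinite completion of `Π^{(S)}` ([SemiAnbd] §6, abc-iut-L2-d1's
  `IsProfiniteCompletion.exists_isProfiniteCompletion`), `G_E := G_K`, `aug_E :=` the extension of
  `G_k ⥲ G_K ∘ aug_S` along the completion (universal property, `IsProfiniteCompletion.exists_extension`);
* `ThetaSetting.exists_completion_package_ofDoubleUnderline` — the package EXISTS at the GENUINE [IUTchII] §1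
  setting `ThetaSetting.ofDoubleUnderline` of the Tate curve `X̲̲_K` (`Π^{(S)} = Π^tp_{X̲̲} = C.Huu`,
  `G_k = G_K ≤ G_{ℚ_p}`, built by abc-iut-L6-d6/L2-t8 from an [EtTh] §1 theta setting), the identification
  `G_K ⥲ Gal(K̄_K/K)` being abc-iut-L3's `TemperedCurve.galoisIdentification`;
* `ThetaSetting.deltaX_map_eq_ofDoubleUnderline_of_coinvariantRankConstant` / `…_of_regime` / `…_of_exists_package` — (H1) AT
  THE GENUINE SETTING modulo, BY NAME, one Thm 2.6 (v) regime (`Δ_E` topologically finitely generated +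
  `CoinvariantRankConstant`, FACT-LIST F-0001) on a compatible completion package.

* `ThetaSetting.isOpenMap_aug_ofDoubleUnderline` / `nonempty_absTopMonoids_ofDoubleUnderline` — the interface
  `AbsTopMonoids` IS INHABITED at the genuine setting modulo «`Π^tp_X → G_K` open» (abc-iut-L2-t11's `D`-indexed
  genuine-models-only input; gives (H2)) and the regime package ((H1)).

HONEST SCOPE: what remains named for the genuine `Π^tp_{X̲̲_K}` is exactly print's input at this point — the
regime hypotheses of [AbsTopI] Thm 2.6 (v) / [AbsAnab] Lemma 1.1.4 (ii) for the profinite `Π_{X̲̲_K}` (supplied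
in print by the geometry of the curve: `Δ` topologically finitely generated, [AbsTopI] Prop 2.2; the rank
computation of [AbsAnab] Lemma 1.1.4).  No curve, no [EtTh] §1 theta setting is asserted to exist (the root
`ThetaSetting p` is interface data).  Nothing here bears on [IUTchIII] Cor. 3.12; no side is taken; typed ≠
proved elsewhere.
-/

noncomputable section

namespace Literature.IUT.HodgeArakelov

open Literature.AnabelianGeometry.AbsoluteAnabelian
open Literature.AnabelianGeometry.SemiGraphs

namespace ThetaSetting

/-! ### The clause `Δ^{(S)} = ι⁻¹(Δ_E)` from compatibility of the augmentations -/

/-- **`Δ^{(S)} = ι⁻¹(Δ_E)` from compatible augmentations.**  If `ι : Π^{(S)} → Π_E` and an INJECTIVE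
homomorphism `g : G_k → G_E` satisfy `aug_E ∘ ι = g ∘ aug_S`, then `Δ^{(S)} = Ker(aug_S) = ι⁻¹(Ker aug_E) =
ι⁻¹(Δ_E)`. [cite: MochizukiSemiAnbd2006, §6 p.69] -/
theorem deltaX_eq_comap_of_aug_compatible (S : ThetaSetting.{0}) (E : FundamentalExtension.{0})
    (ι : S.PiX →ₜ* E.arith) (g : S.Gk →* E.gal) (hg : Function.Injective g)
    (h : ∀ x, E.aug (ι x) = g (S.aug x)) : S.DeltaX = E.geom.comap ι.toMonoidHom := by
  ext x
  rw [Subgroup.mem_comap, MonoidHom.mem_ker, FundamentalExtension.mem_geom]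
  change S.aug x = 1 ↔ E.aug (ι x) = 1
  rw [h]
  constructor
  · intro hx
    rw [hx, map_one]
  · intro hx
    exact hg (by rw [hx, map_one])

/-! ### Tempered (H1) from a compatible completion package -/

/-- **Tempered (H1) from a COMPATIBLE completion package, regime-free form**: `ι : Π^{(S)} → Π_E` a profinite
completion, `aug_E ∘ ι = g ∘ aug_S` with `g` injective, and every automorphism of topological groups of `Π_E`
carrying `Δ_E` onto itself ⇒ every automorphism of `Π^{(S)}` carries `Δ^{(S)}` onto itself.
[cite: MochizukiAbsTopI2012, Thm 2.6 (v) p.22] -/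
theorem deltaX_map_eq_of_completion_compatible (S : ThetaSetting.{0}) (E : FundamentalExtension.{0})
    (ι : S.PiX →ₜ* E.arith) (hι : IsProfiniteCompletion ι) (g : S.Gk →* E.gal)
    (hg : Function.Injective g) (h : ∀ x, E.aug (ι x) = g (S.aug x))
    (hE : ∀ φ : E.arith ≃ₜ* E.arith, FundamentalExtension.PreservesGeom φ)
    (f : S.PiX ≃ₜ* S.PiX) : S.DeltaX.map f.toMulEquiv.toMonoidHom = S.DeltaX :=
  deltaX_map_eq_of_completion_preservesGeom S E ι hι (deltaX_eq_comap_of_aug_compatible S E ι g hg h) hE f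

/-- **Tempered (H1) from a compatible completion package, [AbsTopI] Thm 2.6 (v) regime** (`B : E.MLFBase`,
`Δ_E` topologically finitely generated, `CoinvariantRankConstant` = FACT-LIST F-0001 BY NAME).
[cite: MochizukiAbsTopI2012, Thm 2.6 (v) p.22] -/
theorem deltaX_map_eq_of_completion_compatible_coinvariantRankConstant (S : ThetaSetting.{0})
    (E : FundamentalExtension.{0}) (B : E.MLFBase) (hΔE : IsTopologicallyFinitelyGenerated E.geom)
    (hc : E.CoinvariantRankConstant) (ι : S.PiX →ₜ* E.arith) (hι : IsProfiniteCompletion ι)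
    (g : S.Gk →* E.gal) (hg : Function.Injective g) (h : ∀ x, E.aug (ι x) = g (S.aug x))
    (f : S.PiX ≃ₜ* S.PiX) : S.DeltaX.map f.toMulEquiv.toMonoidHom = S.DeltaX :=
  deltaX_map_eq_of_completion_coinvariantRankConstant S E B hΔE hc ι hι
    (deltaX_eq_comap_of_aug_compatible S E ι g hg h) f

/-- **Tempered (H1) from a compatible completion package, [AbsAnab] Lemma 1.1.4 (ii) regime as printed**
(F-0011 `SplitsOverOpenSubgroup`, `Δ_E` tfg, F-0012 `StarCondition`, BY NAME).
[cite: MochizukiAbsTopI2012, Thm 2.6 (v) p.22] -/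
theorem deltaX_map_eq_of_completion_compatible_starCondition (S : ThetaSetting.{0})
    (E : FundamentalExtension.{0}) (B : E.MLFBase) (hs : E.SplitsOverOpenSubgroup)
    (hΔE : IsTopologicallyFinitelyGenerated E.geom) (hstar : E.StarCondition)
    (ι : S.PiX →ₜ* E.arith) (hι : IsProfiniteCompletion ι)
    (g : S.Gk →* E.gal) (hg : Function.Injective g) (h : ∀ x, E.aug (ι x) = g (S.aug x))
    (f : S.PiX ≃ₜ* S.PiX) : S.DeltaX.map f.toMulEquiv.toMonoidHom = S.DeltaX :=
  deltaX_map_eq_of_completion_starCondition S E B hs hΔE hstar ι hι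
    (deltaX_eq_comap_of_aug_compatible S E ι g hg h) f

/-- **Tempered (H1) from a compatible completion package, [AbsTopI] Thm 2.6 (iv) regime** (`Δ_E` tfg and
pro-`Σ`, `Σ ⊊ Primes`). [cite: MochizukiAbsTopI2012, Thm 2.6 (iv) p.22] -/
theorem deltaX_map_eq_of_completion_compatible_proSigma (S : ThetaSetting.{0})
    (E : FundamentalExtension.{0}) (B : E.MLFBase) (hΔE : E.GeomTFG) {Sigma : Set ℕ}
    (hSigsub : Sigma ⊆ {q | q.Prime}) (hSigne : Sigma ≠ {q | q.Prime}) (hpro : IsProSet E.geom Sigma)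
    (ι : S.PiX →ₜ* E.arith) (hι : IsProfiniteCompletion ι)
    (g : S.Gk →* E.gal) (hg : Function.Injective g) (h : ∀ x, E.aug (ι x) = g (S.aug x))
    (f : S.PiX ≃ₜ* S.PiX) : S.DeltaX.map f.toMulEquiv.toMonoidHom = S.DeltaX :=
  deltaX_map_eq_of_completion_proSigma S E B hΔE hSigsub hSigne hpro ι hι
    (deltaX_eq_comap_of_aug_compatible S E ι g hg h) f

/-! ### Non-vacuity of the completion package -/

/-- **The compatible completion package EXISTS** for every setting whose `G_k` is identified, as a topological
group, with Mathlib's `Gal(K̄/K)` for a finite extension `K/ℚ_p`: take `Π_E :=` the profinite completion of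
`Π^{(S)}` ([SemiAnbd] §6 p. 69: "the profinite completion"; abc-iut `exists_isProfiniteCompletion`),
`G_E := Gal(K̄/K)`, `aug_E :=` the continuous extension of `G_k ⥲ Gal(K̄/K) ∘ aug_S` along the completion
(universal property; surjective because `aug_S` is), with MLF base data `(p, K, id)`.
[cite: MochizukiSemiAnbd2006, §6 p.69] -/
theorem exists_completion_package (S : ThetaSetting.{0}) {p : ℕ} [Fact p.Prime] (K : Type)
    [Field K] [Algebra ℚ_[p] K] [FiniteDimensional ℚ_[p] K]
    (eK : S.Gk ≃ₜ* Field.absoluteGaloisGroup K) :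
    ∃ (E : FundamentalExtension.{0}) (_ : E.MLFBase) (ι : S.PiX →ₜ* E.arith) (g : S.Gk →* E.gal),
      IsProfiniteCompletion ι ∧ Function.Injective g ∧ ∀ x, E.aug (ι x) = g (S.aug x) := by
  haveI : CharZero K := charZero_of_injective_algebraMap (algebraMap ℚ_[p] K).injective
  obtain ⟨P, ι, hι⟩ := IsProfiniteCompletion.exists_isProfiniteCompletion S.PiX
  -- the continuous homomorphism `Π^{(S)} → G_k ⥲ Gal(K̄/K)`
  let ψ : S.PiX →ₜ* Field.absoluteGaloisGroup K :=
    { toMonoidHom := eK.toMulEquiv.toMonoidHom.comp S.aug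
      continuous_toFun := eK.continuous.comp S.aug_continuous }
  have hψ : ∀ x, ψ x = eK (S.aug x) := fun _ => rfl
  obtain ⟨Φ, hΦ⟩ := IsProfiniteCompletion.exists_extension hι ψ
  have hsurj : Function.Surjective Φ := by
    intro y
    obtain ⟨x, hx⟩ := S.aug_surjective (eK.symm y)
    refine ⟨ι x, ?_⟩
    rw [hΦ, hψ, hx, ContinuousMulEquiv.apply_symm_apply]
  let E : FundamentalExtension.{0} :=
    { arith := P
      gal := absoluteGaloisGrp K
      aug := Φ
      aug_surjective := hsurj }
  refine ⟨E, { p := p, K := K, galIso := ContinuousMulEquiv.refl _ }, ι,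
    eK.toMulEquiv.toMonoidHom, hι, eK.injective, fun x => ?_⟩
  change Φ (ι x) = eK (S.aug x)
  rw [hΦ, hψ]

/-- **(H1) packaged for settings with `G_k ⥲ Gal(K̄/K)`**: given such an identification, (H1) for `S` follows
from ONE [AbsTopI] Thm 2.6 (v) regime hypothesis quantified over compatible completion packages — the only
named input left (`Δ_E` tfg + `CoinvariantRankConstant`, FACT-LIST F-0001).
[cite: MochizukiAbsTopI2012, Thm 2.6 (v) p.22] -/
theorem deltaX_characteristic_of_galois_of_regime (S : ThetaSetting.{0}) {p : ℕ} [Fact p.Prime]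
    (K : Type) [Field K] [Algebra ℚ_[p] K] [FiniteDimensional ℚ_[p] K]
    (eK : S.Gk ≃ₜ* Field.absoluteGaloisGroup K)
    (hreg : ∀ (E : FundamentalExtension.{0}) (_ : E.MLFBase) (ι : S.PiX →ₜ* E.arith) (g : S.Gk →* E.gal),
      IsProfiniteCompletion ι → Function.Injective g → (∀ x, E.aug (ι x) = g (S.aug x)) →
        IsTopologicallyFinitelyGenerated E.geom ∧ E.CoinvariantRankConstant) :
    ∀ f : S.PiX ≃ₜ* S.PiX, S.DeltaX.map f.toMulEquiv.toMonoidHom = S.DeltaX := by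
  obtain ⟨E, B, ι, g, hι, hg, h⟩ := exists_completion_package S (p := p) K eK
  obtain ⟨hΔE, hc⟩ := hreg E B ι g hι hg h
  exact deltaX_map_eq_of_completion_compatible_coinvariantRankConstant S E B hΔE hc ι hι g hg h

/-- **(H1) from the EXISTENCE of one compatible completion package in the [AbsTopI] Thm 2.6 (v) regime** (the
usable form: a consumer supplies ONE package — e.g. the one of `exists_completion_package` — with `Δ_E` tfg and
`CoinvariantRankConstant`, FACT-LIST F-0001 BY NAME). [cite: MochizukiAbsTopI2012, Thm 2.6 (v) p.22] -/
theorem deltaX_characteristic_of_exists_package (S : ThetaSetting.{0})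
    (h : ∃ (E : FundamentalExtension.{0}) (_ : E.MLFBase) (ι : S.PiX →ₜ* E.arith) (g : S.Gk →* E.gal),
      IsProfiniteCompletion ι ∧ Function.Injective g ∧ (∀ x, E.aug (ι x) = g (S.aug x)) ∧
        IsTopologicallyFinitelyGenerated E.geom ∧ E.CoinvariantRankConstant) :
    ∀ f : S.PiX ≃ₜ* S.PiX, S.DeltaX.map f.toMulEquiv.toMonoidHom = S.DeltaX := by
  obtain ⟨E, B, ι, g, hι, hg, hc, hΔE, hcr⟩ := h
  exact deltaX_map_eq_of_completion_compatible_coinvariantRankConstant S E B hΔE hcr ι hι g hg hc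

/-! ### The genuine [IUTchII] §1 setting of the Tate curve `X̲̲_K` -/

section Genuine

open Literature.AnabelianGeometry.EtaleTheta
open scoped Literature.AnabelianGeometry.EtaleTheta

variable {p : ℕ} [Fact p.Prime] {D : Literature.AnabelianGeometry.EtaleTheta.ThetaSetting p}
  {ED : D.EtaleThetaData} {l : ℕ} (C : ED.DoubleUnderline l) {N : ℕ+} (μ : D.CyclotomeMod l N)
  (hC : D.Compat) (hS : D.Sec2Hyps) (hl : l.Prime) (hp2 : p ≠ 2) (hpl : p ≠ l)
  (hζ : ∃ ζ : D.K, IsPrimitiveRoot ζ (4 * l)) {η : (C.thetaEnvData μ hC hS).PiYdd → MuN p N}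
  (hη : η ∈ (C.thetaEnvData μ hC hS).thetaCocycles)

/-- **The completion package EXISTS at the genuine setting** `ThetaSetting.ofDoubleUnderline` of the Tate
curve `X̲̲_K` (`Π^{(S)} = Π^tp_{X̲̲}`, `G_k = G_K = Gal(K̄/K) ≤ G_{ℚ_p}`): the identification of `G_K` with
Mathlib's `Gal(K̄_K/K)` is abc-iut-L3's `TemperedCurve.galoisIdentification`, `K/ℚ_p` finite by the
`TemperedCurve` interface. [cite: MochizukiSemiAnbd2006, §6 p.69] -/
theorem exists_completion_package_ofDoubleUnderline :
    ∃ (E : FundamentalExtension.{0}) (_ : E.MLFBase)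
      (ι : (ofDoubleUnderline C μ hC hS hl hp2 hpl hζ hη).PiX →ₜ* E.arith)
      (g : (ofDoubleUnderline C μ hC hS hl hp2 hpl hζ hη).Gk →* E.gal),
      IsProfiniteCompletion ι ∧ Function.Injective g ∧
        ∀ x, E.aug (ι x) = g ((ofDoubleUnderline C μ hC hS hl hp2 hpl hζ hη).aug x) := by
  haveI : FiniteDimensional ℚ_[p] D.K := D.finiteDimensional_K
  exact exists_completion_package (ofDoubleUnderline C μ hC hS hl hp2 hpl hζ hη) (p := p) D.K
    D.toTemperedCurve.galoisIdentification

/-- **(H1) AT THE GENUINE SETTING, from a compatible completion package in the [AbsTopI] Thm 2.6 (v) regime**: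
for ANY profinite completion `ι : Π^tp_{X̲̲} → Π_E` into an MLF-based extension with compatible augmentations
(`g` injective), `Δ_E` topologically finitely generated and `CoinvariantRankConstant` (F-0001 BY NAME), every
automorphism of topological groups of `Π^tp_{X̲̲}` carries `Δ^tp_{X̲̲} = Ker(Π^tp_{X̲̲} ↠ G_K)` onto itself.
[claim: Mochizuki2012, status: disputed] (IUTchII §1 Ex 1.8 (i), kurims p.35) -/
theorem deltaX_map_eq_ofDoubleUnderline_of_coinvariantRankConstant (E : FundamentalExtension.{0})
    (B : E.MLFBase) (hΔE : IsTopologicallyFinitelyGenerated E.geom) (hc : E.CoinvariantRankConstant)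
    (ι : (ofDoubleUnderline C μ hC hS hl hp2 hpl hζ hη).PiX →ₜ* E.arith) (hι : IsProfiniteCompletion ι)
    (g : (ofDoubleUnderline C μ hC hS hl hp2 hpl hζ hη).Gk →* E.gal) (hg : Function.Injective g)
    (h : ∀ x, E.aug (ι x) = g ((ofDoubleUnderline C μ hC hS hl hp2 hpl hζ hη).aug x))
    (f : (ofDoubleUnderline C μ hC hS hl hp2 hpl hζ hη).PiX ≃ₜ*
      (ofDoubleUnderline C μ hC hS hl hp2 hpl hζ hη).PiX) :
    (ofDoubleUnderline C μ hC hS hl hp2 hpl hζ hη).DeltaX.map f.toMulEquiv.toMonoidHom =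
      (ofDoubleUnderline C μ hC hS hl hp2 hpl hζ hη).DeltaX :=
  deltaX_map_eq_of_completion_compatible_coinvariantRankConstant _ E B hΔE hc ι hι g hg h f

/-- **(H1) AT THE GENUINE SETTING modulo ONE named regime**: if every compatible completion package of
`Π^tp_{X̲̲}` with MLF base data has `Δ_E` topologically finitely generated with `CoinvariantRankConstant`
(print: [AbsTopI] Prop 2.2 and the rank computation of [AbsAnab] Lemma 1.1.4 (ii) for `Π_{X̲̲_K}` — FACT-LIST
F-0001), then (H1) holds at `ThetaSetting.ofDoubleUnderline`; the package itself is supplied by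
`exists_completion_package_ofDoubleUnderline`. [claim: Mochizuki2012, status: disputed] (IUTchII §1 Ex 1.8 (i), kurims p.35) -/
theorem deltaX_characteristic_ofDoubleUnderline_of_regime
    (hreg : ∀ (E : FundamentalExtension.{0}) (_ : E.MLFBase)
      (ι : (ofDoubleUnderline C μ hC hS hl hp2 hpl hζ hη).PiX →ₜ* E.arith)
      (g : (ofDoubleUnderline C μ hC hS hl hp2 hpl hζ hη).Gk →* E.gal),
      IsProfiniteCompletion ι → Function.Injective g →
        (∀ x, E.aug (ι x) = g ((ofDoubleUnderline C μ hC hS hl hp2 hpl hζ hη).aug x)) →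
        IsTopologicallyFinitelyGenerated E.geom ∧ E.CoinvariantRankConstant) :
    ∀ f : (ofDoubleUnderline C μ hC hS hl hp2 hpl hζ hη).PiX ≃ₜ*
        (ofDoubleUnderline C μ hC hS hl hp2 hpl hζ hη).PiX,
      (ofDoubleUnderline C μ hC hS hl hp2 hpl hζ hη).DeltaX.map f.toMulEquiv.toMonoidHom =
        (ofDoubleUnderline C μ hC hS hl hp2 hpl hζ hη).DeltaX := by
  haveI : FiniteDimensional ℚ_[p] D.K := D.finiteDimensional_K
  exact deltaX_characteristic_of_galois_of_regime _ (p := p) D.K D.toTemperedCurve.galoisIdentification hreg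

/-- **(H1) AT THE GENUINE SETTING from the existence of ONE compatible completion package in the Thm 2.6 (v)
regime** (the usable form; the package part is inhabited by `exists_completion_package_ofDoubleUnderline`, the
regime part is FACT-LIST F-0001 + `Δ` tfg for that package).
[claim: Mochizuki2012, status: disputed] (IUTchII §1 Ex 1.8 (i), kurims p.35) -/
theorem deltaX_characteristic_ofDoubleUnderline_of_exists_package
    (h : ∃ (E : FundamentalExtension.{0}) (_ : E.MLFBase)
      (ι : (ofDoubleUnderline C μ hC hS hl hp2 hpl hζ hη).PiX →ₜ* E.arith)
      (g : (ofDoubleUnderline C μ hC hS hl hp2 hpl hζ hη).Gk →* E.gal),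
      IsProfiniteCompletion ι ∧ Function.Injective g ∧
        (∀ x, E.aug (ι x) = g ((ofDoubleUnderline C μ hC hS hl hp2 hpl hζ hη).aug x)) ∧
        IsTopologicallyFinitelyGenerated E.geom ∧ E.CoinvariantRankConstant) :
    ∀ f : (ofDoubleUnderline C μ hC hS hl hp2 hpl hζ hη).PiX ≃ₜ*
        (ofDoubleUnderline C μ hC hS hl hp2 hpl hζ hη).PiX,
      (ofDoubleUnderline C μ hC hS hl hp2 hpl hζ hη).DeltaX.map f.toMulEquiv.toMonoidHom =
        (ofDoubleUnderline C μ hC hS hl hp2 hpl hζ hη).DeltaX :=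
  deltaX_characteristic_of_exists_package _ h

/-- **The augmentation of the genuine setting is OPEN as soon as `Π^tp_X → G_K` is** (the `D`-indexed
genuine-models-only input of abc-iut-L2-t11's `Sec2AugOpenOfSetting.lean`, [SemiAnbd] Ex. 3.10 read
topologically): `Π^tp_{X̲̲} ↠ G_K` is its restriction to the OPEN subgroup `Π^tp_{X̲̲} ⊆ Π^tp_X` (`isOpen_Huu`).
[cite: MochizukiEtTh2009, Def 2.13 (i) p.273 (PDF p.47)] -/
theorem isOpenMap_aug_ofDoubleUnderline
    (hopen : IsOpenMap fun x : D.PiTemp => (⟨D.aug x, D.aug_mem_GK x⟩ : D.GK)) :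
    IsOpenMap (ofDoubleUnderline C μ hC hS hl hp2 hpl hζ hη).aug :=
  hopen.comp C.isOpen_Huu.isOpenMap_subtype_val

/-- **The [IUTchII] Ex 1.8 output interface `AbsTopMonoids` IS INHABITED AT THE GENUINE SETTING** of the Tate
curve `X̲̲_K`, modulo the two genuine-models-only inputs: «`Π^tp_X → G_K` is open» ((H2) then holds by the
topological first isomorphism theorem, abc-iut-w5-d105's `AbsTopMonoids.nonempty_iff_of_isOpenMap`) and ONE
compatible MLF completion package in the [AbsTopI] Thm 2.6 (v) regime ((H1), this file; package half PROVED by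
`exists_completion_package_ofDoubleUnderline`, regime half = FACT-LIST F-0001 + `Δ` tfg).  The inhabitant is
abc-iut-w5-d114's `AbsTopMonoids.degenerate` — interface non-vacuity, not the genuine monoids of Ex 1.8 (ii).
[claim: Mochizuki2012, status: disputed] (IUTchII §1 Ex 1.8 (i), kurims p.35) -/
theorem nonempty_absTopMonoids_ofDoubleUnderline
    (hopen : IsOpenMap fun x : D.PiTemp => (⟨D.aug x, D.aug_mem_GK x⟩ : D.GK))
    (h : ∃ (E : FundamentalExtension.{0}) (_ : E.MLFBase)
      (ι : (ofDoubleUnderline C μ hC hS hl hp2 hpl hζ hη).PiX →ₜ* E.arith)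
      (g : (ofDoubleUnderline C μ hC hS hl hp2 hpl hζ hη).Gk →* E.gal),
      IsProfiniteCompletion ι ∧ Function.Injective g ∧
        (∀ x, E.aug (ι x) = g ((ofDoubleUnderline C μ hC hS hl hp2 hpl hζ hη).aug x)) ∧
        IsTopologicallyFinitelyGenerated E.geom ∧ E.CoinvariantRankConstant) :
    Nonempty (AbsTopMonoids (ofDoubleUnderline C μ hC hS hl hp2 hpl hζ hη)) :=
  (AbsTopMonoids.nonempty_iff_of_isOpenMap _ (isOpenMap_aug_ofDoubleUnderline C μ hC hS hl hp2 hpl hζ hη hopen)).2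
    (deltaX_characteristic_ofDoubleUnderline_of_exists_package C μ hC hS hl hp2 hpl hζ hη h)

end Genuine

end ThetaSetting

end Literature.IUT.HodgeArakelov

end
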